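import Literature.Computability.AlgebraicComplexity.GroupTheoreticMatMul
import Literature.LinearAlgebra.Subspace.SpanPairCover
import Literature.LinearAlgebra.Subspace.PuncturedSubspaceCones
import HarnessLib

/-!
# STPP families of punctured subspaces ("frames") over a finite field: the balanced count

Topic `Computability/AlgebraicComplexity`, companion of `GroupTheoreticMatMul.lean` (`IsSTPP`) and
`STPPLineFamilies.lean`.  A *frame family* in a finite vector space `X` over a finite field `F`
(`q = |F|`) is `Aᵢ = Vᵢ ∖ 0`, `Bᵢ = Wᵢ ∖ 0`, `Cᵢ = Uᵢ ∖ 0` for subspaces `Vᵢ, Wᵢ, Uᵢ`; a block is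
FULL if the three sets are non-empty and the family is BALANCED if `|Aᵢ| = |Bᵢ| = |Cᵢ|` for all `i`.

* `IsSTPP.zeroSum_of_frameFamily` — the STPP regrouped: `x ∈ Aᵢ − Bᵢ`, `y ∈ Bⱼ − Cⱼ`,
  `z ∈ C_k − A_k`, `x + y + z = 0` forces `i = j = k`;
* `IsSTPP.direct_of_frameFamily` — for `q ≥ 3` every full block is a direct triple
  (`v + w + u = 0 ⇒ v = w = u = 0` on `Vᵢ × Wᵢ × Uᵢ`; the triple product property, every vector of
  `Vᵢ` being a difference of two elements of `Aᵢ`);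
* `IsSTPP.sq_le_card_of_frameFamily` — a full block forces `q² ≤ |X|`;
* `IsSTPP.balancedFrameFamily_bound` — MAIN: for a full balanced STPP frame family,
  `(Σᵢ |Aᵢ|²)(q + 1) + 7 < 7 |X|`, i.e. `Σᵢ |Aᵢ||Bᵢ| < 7(|X| − 1)/(q + 1)` — a factor `(q+1)/7`
  below the packing bound `Σᵢ |Aᵢ||Bᵢ| ≤ |X|` (line lemma for frames + second-moment cover bound).

Found and proved in the harness (refuter seat on `AlgebraicSTPPDichotomy`, 2026-08-15); no published
source known.  Consumers: `FrameBarrier` / the refutation of `ExactFrameDesign`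
(`Summits/MatrixMultiplication/…/Theses/AlgebraicSTPPDichotomy`).  No named fact, no definition.

## References
* H. Cohn, R. Kleinberg, B. Szegedy, C. Umans, FOCS 2005, arXiv:math/0511460, Def. 5.1.
* J. Blasiak et al., Discrete Analysis 2017:3, arXiv:1605.06702, Def. 2.2, §2 (packing bound).
-/

open Submodule Finset Literature.LinearAlgebra.Subspace

namespace Literature.Computability.AlgebraicComplexity

variable {F X : Type*} [Field F] [AddCommGroup X] [Module F X] {N : ℕ}

/-- **Zero-sum form of the STPP for frame families** (regroup `(s'−s)+(t'−t)+(u'−u)` as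
`(s'−t)+(t'−u)+(u'−s)`): `(v − w) + (w' − u) + (u' − v') = 0` with `v ∈ Aᵢ, w ∈ Bᵢ, w' ∈ Bⱼ,
u ∈ Cⱼ, u' ∈ C_k, v' ∈ A_k` forces `i = j = k`. [folklore] -/
theorem IsSTPP.zeroSum_of_frameFamily {A B C : Fin N → Finset X} (hS : IsSTPP A B C) :
    ∀ (i j k : Fin N), ∀ v ∈ A i, ∀ w ∈ B i, ∀ w' ∈ B j, ∀ u ∈ C j, ∀ u' ∈ C k, ∀ v' ∈ A k,
      (v - w) + (w' - u) + (u' - v') = 0 → i = j ∧ j = k := by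
  intro i j k v hv w hw w' hw' u hu u' hu' v' hv' h
  have := hS i j k v' hv' v hv w hw w' hw' u hu u' hu' (by rw [← h]; abel)
  exact ⟨this.1, this.2.1⟩

/-- Over a field with at least `3` elements, every vector of a subspace `V` with non-empty punctured
part `A = V ∖ 0` is a difference of two elements of `A`. [folklore] -/
theorem exists_sub_eq_of_punctured [Fintype F] [DecidableEq F] (hq : 3 ≤ Fintype.card F)
    (V : Submodule F X) (A : Finset X) (hA : ∀ x, x ∈ A ↔ x ∈ V ∧ x ≠ 0) (hne : A.Nonempty)
    (v : X) (hv : v ∈ V) : ∃ s ∈ A, ∃ s' ∈ A, v = s' - s := by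
  by_cases hv0 : v = 0
  · obtain ⟨a, ha⟩ := hne
    exact ⟨a, ha, a, ha, by rw [hv0, sub_self]⟩
  · -- a scalar `t ∉ {0, -1}`
    obtain ⟨t, ht⟩ : ∃ t : F, t ≠ 0 ∧ t ≠ -1 := by
      have hcard : 1 ≤ ((univ : Finset F) \ {0, -1}).card := by
        have h1 := card_sdiff_add_card_inter (univ : Finset F) {0, -1}
        have h2 : ((univ : Finset F) ∩ {0, -1}).card ≤ 2 :=
          (card_le_card inter_subset_right).trans (card_le_two)
        rw [card_univ] at h1
        omega
      obtain ⟨t, ht⟩ := card_pos.1 hcard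
      simp only [mem_sdiff, mem_univ, mem_insert, mem_singleton, true_and, not_or] at ht
      exact ⟨t, ht.1, ht.2⟩
    refine ⟨t • v, (hA _).2 ⟨smul_mem _ _ hv, smul_ne_zero ht.1 hv0⟩, (1 + t) • v,
      (hA _).2 ⟨smul_mem _ _ hv, smul_ne_zero ?_ hv0⟩, by module⟩
    intro h
    exact ht.2 (eq_neg_of_add_eq_zero_right h)

/-- **Full blocks of an STPP frame family are direct triples** (`q ≥ 3`): if `Aᵢ, Bᵢ, Cᵢ` are the
non-empty punctured parts of `Vᵢ, Wᵢ, Uᵢ`, then `v + w + u = 0` with `v ∈ Vᵢ, w ∈ Wᵢ, u ∈ Uᵢ`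
forces `v = w = u = 0` (the triple product property of the block). [folklore] -/
theorem IsSTPP.direct_of_frameFamily [Fintype F] [DecidableEq F] (hq : 3 ≤ Fintype.card F)
    (V W U : Fin N → Submodule F X) {A B C : Fin N → Finset X}
    (hA : ∀ i x, x ∈ A i ↔ x ∈ V i ∧ x ≠ 0) (hB : ∀ i x, x ∈ B i ↔ x ∈ W i ∧ x ≠ 0)
    (hC : ∀ i x, x ∈ C i ↔ x ∈ U i ∧ x ≠ 0)
    (hfull : ∀ i, (A i).Nonempty ∧ (B i).Nonempty ∧ (C i).Nonempty) (hS : IsSTPP A B C) :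
    ∀ i (v w u : X), v ∈ V i → w ∈ W i → u ∈ U i → v + w + u = 0 → v = 0 ∧ w = 0 ∧ u = 0 := by
  intro i v w u hv hw hu hsum
  obtain ⟨s, hs, s', hs', rfl⟩ := exists_sub_eq_of_punctured hq (V i) (A i) (hA i) (hfull i).1 v hv
  obtain ⟨t, ht, t', ht', rfl⟩ := exists_sub_eq_of_punctured hq (W i) (B i) (hB i) (hfull i).2.1 w hw
  obtain ⟨u₀, hu₀, u', hu', rfl⟩ :=
    exists_sub_eq_of_punctured hq (U i) (C i) (hC i) (hfull i).2.2 u hu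
  obtain ⟨-, -, h1, h2, h3⟩ := hS i i i s hs s' hs' t ht t' ht' u₀ hu₀ u' hu' hsum
  exact ⟨by rw [h1, sub_self], by rw [h2, sub_self], by rw [h3, sub_self]⟩

/-- A full direct block forces `q² ≤ |X|`: for `v ∈ Aᵢ`, `w ∈ Bᵢ`, `w` is off the line of `v`
(`Vᵢ ∩ Wᵢ = 0`), so `span{v, w}` has `q²` vectors. [folklore] -/
theorem sq_le_card_of_direct [Fintype F] [Fintype X] [DecidableEq X] (V W U : Submodule F X)
    (hdir : ∀ (v w u : X), v ∈ V → w ∈ W → u ∈ U → v + w + u = 0 → v = 0 ∧ w = 0 ∧ u = 0)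
    {v w : X} (hv : v ∈ V) (hv0 : v ≠ 0) (hw : w ∈ W) (hw0 : w ≠ 0) :
    Fintype.card F ^ 2 ≤ Fintype.card X := by
  classical
  have hwv : w ∉ span F ({v} : Set X) := by
    intro h
    rw [mem_span_singleton] at h
    obtain ⟨t, rfl⟩ := h
    have := hdir (t • v) (-(t • v)) 0 (smul_mem _ _ hv) (neg_mem hw) (zero_mem _) (by abel)
    exact hw0 this.1
  rw [← card_eq_sq_of_mem_iff_mem_span_pair (F := F) hv0 hwv
    (univ.filter (fun x : X => x ∈ span F ({v, w} : Set X))) (fun x => by simp), ← card_univ]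
  exact card_le_card (filter_subset _ _)

/-- **Balanced full STPP frame families lose a factor `(q+1)/7` against packing.**  Let `X` be a
finite vector space over a field `F` with `q ≥ 3` elements and `|X| ≥ q²`, and let
`(Aᵢ, Bᵢ, Cᵢ)_{i<N}` be the non-empty punctured parts of subspaces `Vᵢ, Wᵢ, Uᵢ` forming an STPP
family with `|Aᵢ| = |Bᵢ| = |Cᵢ|` for every `i`.  Then `(Σᵢ |Aᵢ|²)(q + 1) + 7 < 7 |X|`
(packing gives only `Σᵢ |Aᵢ|² ≤ |X|`).  Proof: the three colour cones have `Σᵢ |Aᵢ|²` vectors each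
(`card_cone_eq_sum`), satisfy the line lemma (`cover_of_zeroSum`, from directness and the zero-sum
form of the STPP), and `card_mul_lt_of_cover` applies.  Found and proved in the harness
(2026-08-15); no published source known. [folklore] -/
theorem IsSTPP.balancedFrameFamily_bound [Fintype F] [DecidableEq F] [Fintype X] [DecidableEq X]
    (hq : 3 ≤ Fintype.card F) (hX : Fintype.card F ^ 2 ≤ Fintype.card X)
    (V W U : Fin N → Submodule F X) {A B C : Fin N → Finset X}
    (hA : ∀ i x, x ∈ A i ↔ x ∈ V i ∧ x ≠ 0) (hB : ∀ i x, x ∈ B i ↔ x ∈ W i ∧ x ≠ 0)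
    (hC : ∀ i x, x ∈ C i ↔ x ∈ U i ∧ x ≠ 0)
    (hfull : ∀ i, (A i).Nonempty ∧ (B i).Nonempty ∧ (C i).Nonempty)
    (hbal : ∀ i, (A i).card = (B i).card ∧ (B i).card = (C i).card) (hS : IsSTPP A B C) :
    (∑ i, (A i).card ^ 2) * (Fintype.card F + 1) + 7 < 7 * Fintype.card X := by
  classical
  have hzero := hS.zeroSum_of_frameFamily
  have hdir := hS.direct_of_frameFamily hq V W U hA hB hC hfull
  -- the three cones
  set ES : Finset X := univ.filter (fun x : X => ∃ i, ∃ v ∈ A i, ∃ w ∈ B i, x = v - w) with hESd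
  set ET : Finset X := univ.filter (fun x : X => ∃ i, ∃ w ∈ B i, ∃ u ∈ C i, x = w - u) with hETd
  set EU : Finset X := univ.filter (fun x : X => ∃ i, ∃ u ∈ C i, ∃ v ∈ A i, x = u - v) with hEUd
  have hES : ∀ x, x ∈ ES ↔ ∃ i, ∃ v ∈ A i, ∃ w ∈ B i, x = v - w := fun x => by simp [hESd]
  have hET : ∀ x, x ∈ ET ↔ ∃ i, ∃ w ∈ B i, ∃ u ∈ C i, x = w - u := fun x => by simp [hETd]
  have hEU : ∀ x, x ∈ EU ↔ ∃ i, ∃ u ∈ C i, ∃ v ∈ A i, x = u - v := fun x => by simp [hEUd]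
  -- rotated directness
  have hdirT : ∀ i (w u v : X), w ∈ W i → u ∈ U i → v ∈ V i → w + u + v = 0 →
      w = 0 ∧ u = 0 ∧ v = 0 := by
    intro i w u v hw hu hv h
    obtain ⟨h1, h2, h3⟩ := hdir i v w u hv hw hu (by rw [← h]; abel)
    exact ⟨h2, h3, h1⟩
  have hdirU : ∀ i (u v w : X), u ∈ U i → v ∈ V i → w ∈ W i → u + v + w = 0 →
      u = 0 ∧ v = 0 ∧ w = 0 := by
    intro i u v w hu hv hw h
    obtain ⟨h1, h2, h3⟩ := hdir i v w u hv hw hu (by rw [← h]; abel)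
    exact ⟨h3, h1, h2⟩
  -- 0 in none of them
  have h0S : (0 : X) ∉ ES := by
    intro h0
    obtain ⟨i, v, hv, w, hw, h⟩ := (hES 0).1 h0
    have := hdir i v (-w) 0 ((hA i v).1 hv).1 (neg_mem ((hB i w).1 hw).1) (zero_mem _)
      (by rw [add_zero, ← sub_eq_add_neg, ← h])
    exact ((hA i v).1 hv).2 this.1
  have h0T : (0 : X) ∉ ET := by
    intro h0
    obtain ⟨i, w, hw, u, hu, h⟩ := (hET 0).1 h0
    have := hdirT i w (-u) 0 ((hB i w).1 hw).1 (neg_mem ((hC i u).1 hu).1) (zero_mem _)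
      (by rw [add_zero, ← sub_eq_add_neg, ← h])
    exact ((hB i w).1 hw).2 this.1
  have h0U : (0 : X) ∉ EU := by
    intro h0
    obtain ⟨i, u, hu, v, hv, h⟩ := (hEU 0).1 h0
    have := hdirU i u (-v) 0 ((hC i u).1 hu).1 (neg_mem ((hA i v).1 hv).1) (zero_mem _)
      (by rw [add_zero, ← sub_eq_add_neg, ← h])
    exact ((hC i u).1 hu).2 this.1
  -- cards of the cones
  have hzeroT : ∀ (i j k : Fin N), ∀ w ∈ B i, ∀ u ∈ C i, ∀ u' ∈ C j, ∀ v ∈ A j, ∀ v' ∈ A k,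
      ∀ w' ∈ B k, (w - u) + (u' - v) + (v' - w') = 0 → i = j ∧ j = k := by
    intro i j k w hw u hu u' hu' v hv v' hv' w' hw' h
    obtain ⟨h1, h2⟩ := hzero k i j v' hv' w' hw' w hw u hu u' hu' v hv (by rw [← h]; abel)
    exact ⟨h2, h1 ▸ h2 ▸ rfl⟩
  have hzeroU : ∀ (i j k : Fin N), ∀ u ∈ C i, ∀ v ∈ A i, ∀ v' ∈ A j, ∀ w ∈ B j, ∀ w' ∈ B k,
      ∀ u' ∈ C k, (u - v) + (v' - w) + (w' - u') = 0 → i = j ∧ j = k := by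
    intro i j k u hu v hv v' hv' w hw w' hw' u' hu' h
    obtain ⟨h1, h2⟩ := hzero j k i v' hv' w hw w' hw' u' hu' u hu v hv (by rw [← h]; abel)
    exact ⟨(h1.trans h2).symm, h1⟩
  have hVW : ∀ i (v : X), v ∈ V i → v ∈ W i → v = 0 := fun i v hv hw =>
    (hdir i v (-v) 0 hv (neg_mem hw) (zero_mem _) (by abel)).1
  have hWU : ∀ i (w : X), w ∈ W i → w ∈ U i → w = 0 := fun i w hw hu =>
    (hdirT i w (-w) 0 hw (neg_mem hu) (zero_mem _) (by abel)).1
  have hUV : ∀ i (u : X), u ∈ U i → u ∈ V i → u = 0 := fun i u hu hv =>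
    (hdirU i u (-u) 0 hu (neg_mem hv) (zero_mem _) (by abel)).1
  have hdisjS : ∀ (i k : Fin N), ∀ v ∈ A i, ∀ w ∈ B i, ∀ v' ∈ A k, ∀ w' ∈ B k,
      v - w = v' - w' → i = k := by
    intro i k v hv w hw v' hv' w' hw' h
    obtain ⟨c, hc⟩ := (hfull k).2.2
    exact (hzero i k k v hv w hw w' hw' c hc c hc v' hv' (by rw [h]; abel)).1
  have hdisjT : ∀ (i k : Fin N), ∀ w ∈ B i, ∀ u ∈ C i, ∀ w' ∈ B k, ∀ u' ∈ C k,
      w - u = w' - u' → i = k := by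
    intro i k w hw u hu w' hw' u' hu' h
    obtain ⟨a, ha⟩ := (hfull k).1
    exact (hzeroT i k k w hw u hu u' hu' a ha a ha w' hw' (by rw [h]; abel)).1
  have hdisjU : ∀ (i k : Fin N), ∀ u ∈ C i, ∀ v ∈ A i, ∀ u' ∈ C k, ∀ v' ∈ A k,
      u - v = u' - v' → i = k := by
    intro i k u hu v hv u' hu' v' hv' h
    obtain ⟨b, hb⟩ := (hfull k).2.1
    exact (hzeroU i k k u hu v hv v' hv' b hb b hb u' hu' (by rw [h]; abel)).1
  have hcS : ES.card = ∑ i, (A i).card ^ 2 := by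
    rw [card_cone_eq_sum V W A B hA hB hVW hdisjS ES hES]
    exact sum_congr rfl (fun i _ => by rw [sq, (hbal i).1])
  have hcT : ET.card = ∑ i, (A i).card ^ 2 := by
    rw [card_cone_eq_sum W U B C hB hC hWU hdisjT ET hET]
    exact sum_congr rfl (fun i _ => by rw [sq, ← (hbal i).2, (hbal i).1])
  have hcU : EU.card = ∑ i, (A i).card ^ 2 := by
    rw [card_cone_eq_sum U V C A hC hA hUV hdisjU EU hEU]
    exact sum_congr rfl (fun i _ => by rw [sq, ← (hbal i).2, ← (hbal i).1])
  -- the cover property = the line lemma for frames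
  have hcover : ∀ (v w : X) (L : Finset X), v ≠ 0 → w ∉ span F ({v} : Set X) →
      (∀ x, x ∈ L ↔ x ∈ span F ({v, w} : Set X)) →
      (ES ∩ L).card + 1 ≤ Fintype.card F ∨ (ET ∩ L).card + 1 ≤ Fintype.card F ∨
        (EU ∩ L).card + 3 ≤ 3 * Fintype.card F :=
    fun v w L hv hw hL =>
      cover_of_zeroSum V W U A B C hA hB hC hdir hzero ES ET EU hES hET hEU v w L hv hw hL
  have hmain := card_mul_lt_of_cover ES ET EU h0S h0T h0U hX hcover
  rw [hcS, hcT, hcU, or_self, or_self] at hmain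
  exact hmain

end Literature.Computability.AlgebraicComplexity
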